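import Literature.Geometry.Lorentzian.CoordUhlenbeckFrame
import Literature.Geometry.Lorentzian.CoordCurvatureEvolution
import Literature.Geometry.Riemannian.HamiltonReactionAlgebra
import HarnessLib

/-!
# The evolution of the curvature components in an Uhlenbeck frame: `∂_t Rm = ΔRm + (M² + M^#)`

The analytic half of Hamilton 1986, §2, p. 157 ("the curvature operator `M` satisfies
`∂M/∂t = ΔM + M² + M^#`" after Uhlenbeck's trick) in the tree's coordinate tensor calculus, for
the proof of the named fact `Literature.Geometry.Riemannian.hamilton_maximumPrinciple_curvatureODE`
(`HamiltonCurvatureODE.lean`). For a smooth one-parameter family of metric components solving the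
Ricci flow in coordinates `∂G/∂t = −2 Ric(G)` (`MetricCoord.IsMetricFamilyOn` + `hfl`) on a
`4`-dimensional model space, at a `G(σ, y)`-orthonormal frame `W : Fin 4 → E`:

* the zeroth-order terms of Topping's Prop. 2.5.1 (`CoordCurvatureEvolution.lean`) and the four
  frame terms of the Leibniz rule (`CoordFrameComponents.lean`) are expressed through the
  components `r = rmComp (G σ) y W` (`quadRiemAt_frame`, `ricAt_frame`, `rmForm_ricOp₁…₄`, …);
* **`dRmForm_uhlenbeck_eq`** — the derivative of `Rm(W_a,W_b,W_c,W_d)` along a frame moved by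
  `W' = Ric^♯(W)` equals `(ΔRm)(W_a,W_b,W_c,W_d) + reaction r a b c d`, where
  `(ΔRm)(…) = Σ_i G((∇²_{W_i,W_i} R)(W_a,W_b)W_c, W_d)` (`lapComp`, the rough Laplacian in the
  orthonormal frame, `MetricCoord.lapRiemAt`) and `CurvComp.reaction` is the array of
  `HamiltonReactionAlgebra.lean`, whose blocks are Hamilton's `(A² + BᵗB + 2A^#, AB + BC − 2B^#,
  C² + ᵗBB + 2C^#)` (`CurvComp.IsAlgCurv.blocks_reaction`);
* `isAlgCurv_rmComp` — the components of the curvature of a metric form an algebraic curvature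
  array (O'Neill 1983, Ch. 3, Prop. 3.36), so that `blocks_reaction` applies.

Everything is proved; no definition of `Prop` type is introduced.

## References

* R. S. Hamilton, *Four-manifolds with positive curvature operator*, J. Differential Geom. 24
  (1986) 153–179, §2, p. 157. [Hamilton1986]
* P. Topping, *Lectures on the Ricci flow*, LMS Lecture Note Series 325, CUP 2006, Prop. 2.4.1,
  Prop. 2.5.1, Remark 2.5.2. [Topping2006]
* B. O'Neill, *Semi-Riemannian geometry*, Academic Press 1983, Ch. 3, Prop. 3.36, Lemma 3.52.
  [ONeill1983]
-/

noncomputable section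

set_option maxSynthPendingDepth 3

open Set Filter ContinuousLinearMap Module
open scoped Topology ContDiff

namespace Literature.Geometry.Riemannian

open Lorentzian Lorentzian.MetricCoord CurvComp

variable {E : Type*} [NormedAddCommGroup E] [NormedSpace ℝ E]

/-! ### Sums in the slots of the curvature form -/

section Sums

variable (G : E → E →L[ℝ] E →L[ℝ] ℝ) {κ : Type*} (s : Finset κ) (c : κ → ℝ) (v : κ → E)

/-- `Rm(Σ cᵢvᵢ, Y, Z, U) = Σ cᵢ Rm(vᵢ, Y, Z, U)`. [folklore] -/
theorem rmForm_sum_smul₁ (y Y Z U : E) :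
    rmForm G y (∑ i ∈ s, c i • v i) Y Z U = ∑ i ∈ s, c i * rmForm G y (v i) Y Z U := by
  classical
  induction s using Finset.induction_on with
  | empty => simpa using rmForm_smul₁ G y 0 0 Y Z U
  | insert a s ha ih => rw [Finset.sum_insert ha, Finset.sum_insert ha, rmForm_add₁, rmForm_smul₁, ih]

/-- `Rm(X, Σ cᵢvᵢ, Z, U) = Σ cᵢ Rm(X, vᵢ, Z, U)`. [folklore] -/
theorem rmForm_sum_smul₂ (y X Z U : E) :
    rmForm G y X (∑ i ∈ s, c i • v i) Z U = ∑ i ∈ s, c i * rmForm G y X (v i) Z U := by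
  classical
  induction s using Finset.induction_on with
  | empty => simpa using rmForm_smul₂ G y 0 X 0 Z U
  | insert a s ha ih => rw [Finset.sum_insert ha, Finset.sum_insert ha, rmForm_add₂, rmForm_smul₂, ih]

/-- `Rm(X, Y, Σ cᵢvᵢ, U) = Σ cᵢ Rm(X, Y, vᵢ, U)`. [folklore] -/
theorem rmForm_sum_smul₃ (y X Y U : E) :
    rmForm G y X Y (∑ i ∈ s, c i • v i) U = ∑ i ∈ s, c i * rmForm G y X Y (v i) U := by
  classical
  induction s using Finset.induction_on with
  | empty => simpa using rmForm_smul₃ G y 0 X Y 0 U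
  | insert a s ha ih => rw [Finset.sum_insert ha, Finset.sum_insert ha, rmForm_add₃, rmForm_smul₃, ih]

/-- `Rm(X, Y, Z, Σ cᵢvᵢ) = Σ cᵢ Rm(X, Y, Z, vᵢ)`. [folklore] -/
theorem rmForm_sum_smul₄ (y X Y Z : E) :
    rmForm G y X Y Z (∑ i ∈ s, c i • v i) = ∑ i ∈ s, c i * rmForm G y X Y Z (v i) := by
  classical
  induction s using Finset.induction_on with
  | empty => simpa using rmForm_smul₄ G y 0 X Y Z 0
  | insert a s ha ih => rw [Finset.sum_insert ha, Finset.sum_insert ha, rmForm_add₄, rmForm_smul₄, ih]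

end Sums

/-! ### The zeroth-order terms in an orthonormal `4`-frame -/

section Static

variable [FiniteDimensional ℝ E] {G : E → E →L[ℝ] E →L[ℝ] ℝ} {V : Set E} {y : E}
  {W : Fin 4 → E}

omit [FiniteDimensional ℝ E] in
/-- `card (Fin 4) = dim E` on a `4`-dimensional model space. [folklore] -/
theorem card_fin_four_eq (h4 : finrank ℝ E = 4) : Fintype.card (Fin 4) = finrank ℝ E := by
  rw [h4, Fintype.card_fin]

omit [FiniteDimensional ℝ E] in
/-- **The components of the curvature of metric components form an algebraic curvature array**
(O'Neill 1983, Ch. 3, Prop. 3.36, on the frame `W`). [cite: ONeill1983, Ch. 3, Prop. 3.36] -/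
theorem isAlgCurv_rmComp [CompleteSpace E] (hG : IsMetricOn G V) (hy : y ∈ V) (W : Fin 4 → E) :
    IsAlgCurv (rmComp G y W) where
  antisymm₁₂ a b c d := rmComp_antisymm₁₂ W a b c d
  antisymm₃₄ a b c d := hG.rmComp_antisymm₃₄ hy W a b c d
  pair_comm a b c d := hG.rmComp_pair_comm hy W a b c d
  cyclic a b c d := hG.rmComp_cyclic hy W a b c d

variable (hG : IsMetricOn G V) (hy : y ∈ V) (hW : IsONFrame (G y) W) (h4 : finrank ℝ E = 4)
include hG hy hW h4

omit [FiniteDimensional ℝ E] hG hy in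
/-- Expansion of a vector in the orthonormal frame: `v = Σ_m G(v, W_m) W_m`. [folklore] -/
theorem eq_sum_frame (v : E) : v = ∑ m, G y v (W m) • W m := by
  have h := sum_apply_smul_of_orthonormal (hW.toBasis (card_fin_four_eq h4))
    (hW.toBasis_orthonormal (card_fin_four_eq h4)) v
  simp only [IsONFrame.coe_toBasis] at h
  exact h.symm

omit hG hy in
/-- **The Ricci form on the frame**: `Ric(W_m, W_d) = ric r m d = Σ_k Rm(W_k, W_m, W_d, W_k)`.
[cite: ONeill1983, Ch. 3, Lemma 3.52] -/
theorem ricAt_frame (m d : Fin 4) : ricAt G y (W m) (W d) = ric (rmComp G y W) m d := by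
  have h := ricAt_eq_sum_of_orthonormal (hW.toBasis (card_fin_four_eq h4))
    (hW.toBasis_orthonormal (card_fin_four_eq h4)) (W m) (W d)
  simp only [IsONFrame.coe_toBasis] at h
  simpa [ric, rmComp, rmForm] using h

omit hG hy in
/-- `Ric(R(W_a,W_b)W_c, W_d) = Σ_m Rm(a,b,c,m) ric(m,d)`. [cite: Topping2006, Prop. 2.5.1] -/
theorem ricAt_riemAt_frame (a b c d : Fin 4) :
    ricAt G y (riemAt G y (W a) (W b) (W c)) (W d) = ∑ m, rmComp G y W a b c m * ric (rmComp G y W) m d := by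
  conv_lhs => rw [eq_sum_frame hW h4 (riemAt G y (W a) (W b) (W c))]
  rw [map_sum, sum_apply]
  refine Finset.sum_congr rfl fun m _ ↦ ?_
  rw [map_smul, smul_apply, smul_eq_mul, ricAt_frame hW h4]
  rfl

omit hG hy in
/-- `Ric(W_c, R(W_a,W_b)W_d) = Σ_m Rm(a,b,d,m) ric(c,m)`. [cite: Topping2006, Prop. 2.5.1] -/
theorem ricAt_riemAt_frame' (a b c d : Fin 4) :
    ricAt G y (W c) (riemAt G y (W a) (W b) (W d)) = ∑ m, rmComp G y W a b d m * ric (rmComp G y W) c m := by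
  conv_lhs => rw [eq_sum_frame hW h4 (riemAt G y (W a) (W b) (W d))]
  rw [map_sum]
  refine Finset.sum_congr rfl fun m _ ↦ ?_
  rw [map_smul, smul_eq_mul, ricAt_frame hW h4]
  rfl

/-- The Uhlenbeck velocity on the frame: `Ric^♯(W_a) = Σ_p ric(a,p) W_p`. [cite: Hamilton1986, §2, p. 157] -/
theorem ricOp_frame (a : Fin 4) : ricOp G y (W a) = ∑ p, ric (rmComp G y W) a p • W p := by
  conv_lhs => rw [eq_sum_frame hW h4 (ricOp G y (W a))]
  refine Finset.sum_congr rfl fun p _ ↦ ?_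
  rw [apply_ricOp (hG.isInvertible y hy), ricAt_frame hW h4]

/-- Frame term, slot 1: `Rm(Ric^♯W_a, W_b, W_c, W_d) = Σ_p ric(a,p) r p b c d`.
[cite: Hamilton1986, §2, p. 157] -/
theorem rmForm_ricOp₁ (a b c d : Fin 4) :
    rmForm G y (ricOp G y (W a)) (W b) (W c) (W d) = ∑ p, ric (rmComp G y W) a p * rmComp G y W p b c d := by
  rw [ricOp_frame hG hy hW h4, rmForm_sum_smul₁]; rfl

/-- Frame term, slot 2. [cite: Hamilton1986, §2, p. 157] -/
theorem rmForm_ricOp₂ (a b c d : Fin 4) :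
    rmForm G y (W a) (ricOp G y (W b)) (W c) (W d) = ∑ p, ric (rmComp G y W) b p * rmComp G y W a p c d := by
  rw [ricOp_frame hG hy hW h4, rmForm_sum_smul₂]; rfl

/-- Frame term, slot 3. [cite: Hamilton1986, §2, p. 157] -/
theorem rmForm_ricOp₃ (a b c d : Fin 4) :
    rmForm G y (W a) (W b) (ricOp G y (W c)) (W d) = ∑ p, ric (rmComp G y W) c p * rmComp G y W a b p d := by
  rw [ricOp_frame hG hy hW h4, rmForm_sum_smul₃]; rfl

/-- Frame term, slot 4. [cite: Hamilton1986, §2, p. 157] -/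
theorem rmForm_ricOp₄ (a b c d : Fin 4) :
    rmForm G y (W a) (W b) (W c) (ricOp G y (W d)) = ∑ p, ric (rmComp G y W) d p * rmComp G y W a b c p := by
  rw [ricOp_frame hG hy hW h4, rmForm_sum_smul₄]; rfl

/-- **Topping's quadratic term on the frame**: `quadRiemAt` (in the basis of the frame) at frame
vectors is `CurvComp.quad` of the components. [cite: Topping2006, §2.4, (2.4.2)] -/
theorem quadRiemAt_frame (a c z w : Fin 4) :
    quadRiemAt G (hW.toBasis (card_fin_four_eq h4)) y (W a) (W c) (W z) (W w) =
      quad (rmComp G y W) a c z w := by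
  set bW := hW.toBasis (card_fin_four_eq h4) with hbW
  have he := hW.toBasis_orthonormal (card_fin_four_eq h4)
  have hcoe : ⇑bW = W := hW.coe_toBasis _
  have hx := hG.isInvertible y hy
  rw [quadRiemAt_of_orthonormal bW he hx]
  unfold quad
  refine Finset.sum_congr rfl fun k _ ↦ ?_
  -- the four terms of `Q_k`
  have hz : W z = bW z := by rw [hcoe]
  have hw : W w = bW w := by rw [hcoe]
  have t1 : G y ((riemAt G y (bW k) (W a)).comp (riemAt G y (W c) (bW k)) (W z)) (W w) =
      ∑ m, rmComp G y W c k z m * rmComp G y W k a m w := by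
    rw [ContinuousLinearMap.comp_apply, hz, hw, apply_comp_of_orthonormal bW he]
    simp only [hcoe, rmComp, rmForm]
  have t2 : G y ((riemAt G y (W c) (bW k)).comp (riemAt G y (bW k) (W a)) (W z)) (W w) =
      ∑ m, rmComp G y W k a z m * rmComp G y W c k m w := by
    rw [ContinuousLinearMap.comp_apply, hz, hw, apply_comp_of_orthonormal bW he]
    simp only [hcoe, rmComp, rmForm]
  have t3 : G y (riemAt G y (riemAt G y (bW k) (W a) (W c)) (bW k) (W z)) (W w) =
      ∑ m, rmComp G y W k a c m * rmComp G y W m k z w := by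
    conv_lhs => rw [eq_sum_frame hW h4 (riemAt G y (bW k) (W a) (W c))]
    have := rmForm_sum_smul₁ G Finset.univ (fun m ↦ G y (riemAt G y (bW k) (W a) (W c)) (W m)) W y
      (bW k) (W z) (W w)
    simp only [rmForm] at this
    rw [this]
    simp only [hcoe, rmComp, rmForm]
  have t4 : G y (riemAt G y (W c) (riemAt G y (bW k) (W a) (bW k)) (W z)) (W w) =
      ∑ m, rmComp G y W k a k m * rmComp G y W c m z w := by
    conv_lhs => rw [eq_sum_frame hW h4 (riemAt G y (bW k) (W a) (bW k))]
    have := rmForm_sum_smul₂ G Finset.univ (fun m ↦ G y (riemAt G y (bW k) (W a) (bW k)) (W m)) W y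
      (W c) (W z) (W w)
    simp only [rmForm] at this
    rw [this]
    simp only [hcoe, rmComp, rmForm]
  simp only [map_sub, _root_.sub_apply, t1, t2, t3, t4, ← Finset.sum_sub_distrib]

/-- **The rough Laplacian on the frame**: in the basis of an orthonormal frame,
`G((ΔR)(W_a,W_b)W_c, W_d) = Σ_i G((∇²_{W_i,W_i}R)(W_a,W_b)W_c, W_d)`. [cite: Topping2006, §2.4, (2.4.1)] -/
theorem lapRiemAt_frame (a b c d : Fin 4) :
    G y (lapRiemAt G (hW.toBasis (card_fin_four_eq h4)) y (W a) (W b) (W c)) (W d) =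
      ∑ i, G y (cov2RiemAt G y (W i) (W i) (W a) (W b) (W c)) (W d) := by
  set bW := hW.toBasis (card_fin_four_eq h4) with hbW
  have he := hW.toBasis_orthonormal (card_fin_four_eq h4)
  have hcoe : ⇑bW = W := hW.coe_toBasis _
  have hx := hG.isInvertible y hy
  unfold lapRiemAt
  simp only [ginv_of_orthonormal bW he hx, ite_smul, one_smul, zero_smul, Finset.sum_ite_eq,
    Finset.mem_univ, if_true, sum_apply, map_sum, hcoe]

end Static

/-! ### The evolution of the components in an Uhlenbeck frame -/

section Family

variable [FiniteDimensional ℝ E] [CompleteSpace E] {G : ℝ → E → E →L[ℝ] E →L[ℝ] ℝ} {S : Set ℝ}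
  {V : Set E} {y : E} {σ : ℝ}

/-- The **rough Laplacian of the curvature on a frame**:
`lapComp G y W a b c d = Σ_i G_y((∇²_{W_i,W_i} R)(W_a,W_b)W_c, W_d)` — for an orthonormal frame the
component `(ΔRm)(W_a,W_b,W_c,W_d)` of Topping's `Δ = tr ∇²` (`lapRiemAt_frame`).
[cite: Topping2006, §2.4, (2.4.1)] -/
def lapComp (G : E → E →L[ℝ] E →L[ℝ] ℝ) (y : E) (W : Fin 4 → E) (a b c d : Fin 4) : ℝ :=
  ∑ i, G y (cov2RiemAt G y (W i) (W i) (W a) (W b) (W c)) (W d)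

/-- **Hamilton 1986, §2 (p. 157): `∂M/∂t = ΔM + M² + M^#` in an Uhlenbeck frame, componentwise.**
Along a smooth family solving the Ricci flow in coordinates, at a `G(σ,y)`-orthonormal `4`-frame
`W` on a `4`-dimensional model space, the time derivative of `Rm(W_a,W_b,W_c,W_d)` corrected by
the four Uhlenbeck frame terms `Rm(Ric^♯W_a, …) + … + Rm(…, Ric^♯W_d)` (the derivative along a frame
moved by `W' = Ric^♯(W)`, `hasDerivWithinAt_rmComp_frame`) equals
`(ΔRm)(W_a,W_b,W_c,W_d) + reaction r a b c d`, `r = rmComp (G σ) y W` — Topping's Prop. 2.5.1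
(`hasDerivWithinAt_apply_riemAt_ricciFlow`) read on the frame. [cite: Hamilton1986, §2, p. 157]
[cite: Topping2006, Prop. 2.5.1] -/
theorem dRmForm_uhlenbeck_eq (hG : IsMetricFamilyOn G S V)
    (hfl : ∀ s ∈ S, ∀ x ∈ V, tDeriv G S s x = (-2 : ℝ) • ricAt (G s) x) (hy : y ∈ V) (hσ : σ ∈ S)
    {W : Fin 4 → E} (hW : IsONFrame (G σ y) W) (h4 : finrank ℝ E = 4) (a b c d : Fin 4) :
    dRmForm G S σ y (W a) (W b) (W c) (W d)
      + rmForm (G σ) y (ricOp (G σ) y (W a)) (W b) (W c) (W d)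
      + rmForm (G σ) y (W a) (ricOp (G σ) y (W b)) (W c) (W d)
      + rmForm (G σ) y (W a) (W b) (ricOp (G σ) y (W c)) (W d)
      + rmForm (G σ) y (W a) (W b) (W c) (ricOp (G σ) y (W d)) =
    lapComp (G σ) y W a b c d + reaction (rmComp (G σ) y W) a b c d := by
  have hGσ := hG.isMetricOn σ hσ
  set bW := hW.toBasis (card_fin_four_eq h4) with hbW
  -- Prop. 2.5.1 identifies `∂_t Rm`
  have hd : dRmForm G S σ y (W a) (W b) (W c) (W d) =
      G σ y (lapRiemAt (G σ) bW y (W a) (W b) (W c)) (W d)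
        + quadRiemAt (G σ) bW y (W a) (W b) (W c) (W d) - quadRiemAt (G σ) bW y (W b) (W a) (W c) (W d)
        - ricAt (G σ) y (riemAt (G σ) y (W a) (W b) (W c)) (W d)
        + ricAt (G σ) y (W c) (riemAt (G σ) y (W a) (W b) (W d)) :=
    hG.dRmForm_eq_of_hasDerivWithinAt hσ (hG.hasDerivWithinAt_apply_riemAt_ricciFlow bW hfl hy hσ _ _ _ _)
  rw [hd, lapRiemAt_frame hGσ hy hW h4, quadRiemAt_frame hGσ hy hW h4, quadRiemAt_frame hGσ hy hW h4,
    ricAt_riemAt_frame hW h4, ricAt_riemAt_frame' hW h4, rmForm_ricOp₁ hGσ hy hW h4,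
    rmForm_ricOp₂ hGσ hy hW h4, rmForm_ricOp₃ hGσ hy hW h4, rmForm_ricOp₄ hGσ hy hW h4]
  unfold lapComp reaction
  simp only [Finset.sum_add_distrib]
  ring

end Family

end Literature.Geometry.Riemannian

end
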